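import Literature.NumberTheory.LFunctions.ColossallyAbundantChain
import HarnessLib
import HarnessLib.Audit

/-!
# The Alaoglu–Erdős question on rational powers of two primes

Topic: `Literature/NumberTheory/LFunctions`. Definition file accompanying the proof file
`ColossallyAbundantChain.lean` (provefact `Nat.caSeq_dvd_succ`), which spells the statement
below out as a hypothesis `hAE`; here it gets its name, and the results of that file (and of
`ColossallyAbundantQuotient.lean`) are re-exported under it.

## Content

* `Nat.AlaogluErdosConjecture : Prop` — "If `p` and `q` are different primes, is it true that
  `p^x` and `q^x` are both rational only if `x` is an integer?" (Alaoglu–Erdős 1944, p. 449;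
  p. 455: "It is very likely that `q^x` and `p^x` can not be rational at the same time except if
  `x` is an integer. … At present we can not show this"). **Open** — not dischargeable,
  hypothesis only (Lagarias 2002, §2: "raised the following question, which is still unsolved").
  Users take `(h : Nat.AlaogluErdosConjecture)`.
* Proved about it: `Nat.alaogluErdosConjecture_of_fourExponentialsConjecture` (it follows from
  `Literature.NumberTheory.Transcendental.FourExponentialsConjecture`; Lagarias 2002, §2, footnote 2),
  `Nat.alaogluErdosConjecture_ratCast` (the case of rational `x` holds, already for one prime),
  `Nat.exists_ratCast_eq_natCast_rpow_intCast` (the converse implication is trivial).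
* Consequences for the colossally abundant numbers of the tree (`Nat.ColossallyAbundant`,
  all-maximisers convention; Alaoglu–Erdős 1944, p. 455: a positive answer "would show that the
  quotient of two consecutive colossally abundant numbers is a prime"):
  `Nat.AlaogluErdosConjecture.not_two_ties`,
  `Nat.ColossallyAbundant.consecutive_quotient_of_alaogluErdosConjecture`,
  `Nat.caSeq_succ_eq_prime_mul_of_alaogluErdosConjecture`,
  `Nat.AlaogluErdos1944_quotient_of_alaogluErdosConjecture`,
  `Nat.caSeq_dvd_succ_of_alaogluErdosConjecture` (the named fact `Nat.caSeq_dvd_succ` of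
  `ColossallyAbundant.lean` is, for this convention and granted the six exponentials theorem,
  *equivalent* to "no parameter is critical for two primes", `Nat.caSeq_dvd_succ_iff` in
  `ColossallyAbundantQuotient.lean`, hence a consequence of the present open statement and not
  an unconditional theorem of the 1944 paper),
  `Nat.caSeq_div_prime_of_alaogluErdosConjecture`,
  `Nat.ColossallyAbundant.dvd_of_le_of_alaogluErdosConjecture`.

## Sources

* L. Alaoglu, P. Erdős, *On highly composite and similar numbers*, Trans. AMS 56 (1944),
  448–469: p. 449 (the question), §3, p. 455. [AlaogluErdos1944]
  (held: doi 10.1090/s0002-9947-1944-0011087-2, PDF pp. 2 and 8.)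
* J. C. Lagarias, *An elementary problem equivalent to the Riemann hypothesis*, Amer. Math.
  Monthly 109 (2002), 534–543; arXiv math/0008177, §2 "Colossally Abundant Numbers", pp. 3–4
  ("Conjecture (Alaoglu and Erdős)"; footnote 2; "If the conjecture of Alaoglu and Erdős above
  has a positive answer, then no values of `ε` will have four extremal integers").
  [Lagarias2002]

## Design choices

* Stated over a real exponent `x`, for two *distinct* primes as printed on p. 449 (Lagarias's
  paraphrase says "both primes" without "different"; allowing `p = q` would include the
  one-prime statement, which is false: `2^{log 3 / log 2} = 3`). "Rational" is membership in
  the range of `ℚ → ℝ`, "integer" in the range of `ℤ → ℝ`, written with `∃` exactly as in the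
  hypothesis `hAE` of `ColossallyAbundantChain.lean`, so that `(h : Nat.AlaogluErdosConjecture)`
  can be passed to those theorems as is (the definition unfolds by `Iff.rfl`,
  `Nat.alaogluErdosConjecture_iff`).
* Namespace `Nat` and the name used by the reviews of p5094/p5370, which checked this wording
  against the held PDF.
-/

noncomputable section

open Real
open scoped ArithmeticFunction.sigma

namespace Nat

/-- **The Alaoglu–Erdős question / conjecture** (Alaoglu–Erdős 1944, p. 449: "If `p` and `q` are
different primes, is it true that `p^x` and `q^x` are both rational only if `x` is an
integer?"; p. 455: "It is very likely that `q^x` and `p^x` can not be rational at the same time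
except if `x` is an integer. This would show that the quotient of two consecutive colossally
abundant numbers is a prime. At present we can not show this."). **Open** — not dischargeable,
hypothesis only (Lagarias 2002, §2: "still unsolved"; it follows from the four exponentials
conjecture, `Nat.alaogluErdosConjecture_of_fourExponentialsConjecture`). For distinct primes
`p, q` and real `x`: if `p^x ∈ ℚ` and `q^x ∈ ℚ` then `x ∈ ℤ`.
Users take `(h : Nat.AlaogluErdosConjecture)`.
[cite: AlaogluErdos1944, p. 449 (the Diophantine question); §3, p. 455] -/
@[conjecture] def AlaogluErdosConjecture : Prop :=
  ∀ (p q : ℕ) (x : ℝ), p.Prime → q.Prime → p ≠ q →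
    (∃ a : ℚ, (p : ℝ) ^ x = a) → (∃ b : ℚ, (q : ℝ) ^ x = b) → ∃ k : ℤ, x = k

/-- Unfolding lemma. [cite: AlaogluErdos1944, p. 449] -/
theorem alaogluErdosConjecture_iff :
    AlaogluErdosConjecture ↔
      ∀ (p q : ℕ) (x : ℝ), p.Prime → q.Prime → p ≠ q →
        (∃ a : ℚ, (p : ℝ) ^ x = a) → (∃ b : ℚ, (q : ℝ) ^ x = b) → ∃ k : ℤ, x = k :=
  Iff.rfl

/-! ### What is known about the question -/

/-- The converse implication is trivial: an integer exponent gives rational powers,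
`p^k = (p^k : ℚ)`; the question is the "only if". [folklore] -/
theorem exists_ratCast_eq_natCast_rpow_intCast (p : ℕ) (k : ℤ) :
    ∃ a : ℚ, (p : ℝ) ^ (k : ℝ) = a :=
  ⟨(p : ℚ) ^ k, by rw [Real.rpow_intCast]; push_cast; rfl⟩

/-- **The rational case holds, already for one prime** (Lagarias 2002, §2, footnote 2: "For
non-integer rational `x` a direct argument is used"): if `p` is prime, `x = r ∈ ℚ` and
`p^x ∈ ℚ`, then `x ∈ ℤ` (`Nat.exists_intCast_eq_of_prime_rpow_ratCast`,
`ColossallyAbundantChain.lean`, by `p`-adic valuation). So the open content of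
`Nat.AlaogluErdosConjecture` is the case of irrational `x`, where one prime does not suffice
(`2^{log 3 / log 2} = 3`). [cite: Lagarias2002, §2 (footnote 2)] -/
theorem alaogluErdosConjecture_ratCast {p : ℕ} (hp : p.Prime) (r : ℚ)
    (h : ∃ a : ℚ, (p : ℝ) ^ (r : ℝ) = a) : ∃ k : ℤ, (r : ℝ) = k := by
  obtain ⟨a, ha⟩ := h
  exact exists_intCast_eq_of_prime_rpow_ratCast hp ha

/-- **The four exponentials conjecture implies a positive answer to the Alaoglu–Erdős question**
(Lagarias 2002, §2: "This conjecture would follow as a consequence of the four exponentials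
conjecture"; footnote 2: `a₁ = log p`, `a₂ = log q`, `b₁ = 1`, `b₂ = x` for irrational `x`).
The proof is `Nat.alaogluErdos_of_fourExponentials` (`ColossallyAbundantChain.lean`); the four
exponentials conjecture is the tree's `Literature.NumberTheory.Transcendental.FourExponentialsConjecture`
(`Transcendental/PeriodsWave0.lean`), itself open. [cite: Lagarias2002, §2 (footnote 2)] -/
theorem alaogluErdosConjecture_of_fourExponentialsConjecture
    (h4 : Literature.NumberTheory.Transcendental.FourExponentialsConjecture) : AlaogluErdosConjecture :=
  alaogluErdos_of_fourExponentials h4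

/-! ### Consequences for colossally abundant numbers (tree convention) -/

/-- Under the Alaoglu–Erdős conjecture no positive parameter `ε` is critical for two distinct
primes: `σ(p^{a+1})/σ(p^a) = p^{1+ε}` and `σ(q^{b+1})/σ(q^b) = q^{1+ε}` with `p ≠ q` is
impossible (both powers would be rational, so `1 + ε ∈ ℤ`, whereas such an `ε` is irrational).
Alaoglu–Erdős 1944, p. 455: a critical `ε` "makes `q^x` rational".
[cite: AlaogluErdos1944, §3, p. 455] -/
theorem AlaogluErdosConjecture.not_two_ties (hAE : AlaogluErdosConjecture) {ε : ℝ} (hε : 0 < ε)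
    {p q a b : ℕ} (hp : p.Prime) (hq : q.Prime) (hpq : p ≠ q)
    (ha : (σ 1 (p ^ (a + 1)) : ℝ) / σ 1 (p ^ a) = (p : ℝ) ^ (1 + ε))
    (hb : (σ 1 (q ^ (b + 1)) : ℝ) / σ 1 (q ^ b) = (q : ℝ) ^ (1 + ε)) : False :=
  not_two_ties_of_alaogluErdos hAE hε hp hq hpq ha hb

/-- Under the Alaoglu–Erdős conjecture the quotient of two consecutive colossally abundant
numbers (tree convention: `n < n'` colossally abundant with no colossally abundant number
strictly between) is a single prime (Alaoglu–Erdős 1944, p. 455: "This would show that the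
quotient of two consecutive colossally abundant numbers is a prime").
[cite: AlaogluErdos1944, §3, p. 455] -/
theorem ColossallyAbundant.consecutive_quotient_of_alaogluErdosConjecture
    (hAE : AlaogluErdosConjecture) {n n' : ℕ} (hn : ColossallyAbundant n)
    (hn' : ColossallyAbundant n') (hlt : n < n')
    (hnone : ∀ m : ℕ, n < m → m < n' → ¬ ColossallyAbundant m) :
    ∃ p : ℕ, p.Prime ∧ n' = p * n :=
  hn.consecutive_quotient_of_alaogluErdos hAE hn' hlt hnone

/-- Under the Alaoglu–Erdős conjecture, along the enumeration `Nat.caSeq`: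
`caSeq (k+1) = p · caSeq k` for some prime `p`. [cite: AlaogluErdos1944, §3, p. 455] -/
theorem caSeq_succ_eq_prime_mul_of_alaogluErdosConjecture (hAE : AlaogluErdosConjecture)
    (k : ℕ) : ∃ p : ℕ, p.Prime ∧ caSeq (k + 1) = p * caSeq k :=
  caSeq_succ_eq_prime_mul_of_alaogluErdos hAE k

/-- Under the Alaoglu–Erdős conjecture the named fact `Nat.AlaogluErdos1944_quotient`
(`ColossallyAbundant.lean`) holds, in its first alternative (a single prime).
[cite: AlaogluErdos1944, §3, p. 455] -/
theorem AlaogluErdos1944_quotient_of_alaogluErdosConjecture (hAE : AlaogluErdosConjecture) :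
    AlaogluErdos1944_quotient :=
  AlaogluErdos1944_quotient_of_alaogluErdos hAE

/-- **`Nat.caSeq_dvd_succ` under the Alaoglu–Erdős conjecture:** consecutive colossally
abundant numbers (tree convention) divide each other. This is the status of the named fact
`Nat.caSeq_dvd_succ` (`ColossallyAbundant.lean`): for the all-maximisers convention it is a
consequence of the present open question — granted the six exponentials theorem it is even
equivalent to "no parameter is critical for two primes" (`Nat.caSeq_dvd_succ_iff`,
`ColossallyAbundantQuotient.lean`) — whereas the divisibility chain Alaoglu–Erdős state on
p. 455 ("the numbers `n_ε` … do not decrease as `ε` decreases") concerns their one colossally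
abundant number per `ε` and holds unconditionally
(`Nat.IsCAParameter.dvd_of_le_of_forall_lt`, `ColossallyAbundantChain.lean`).
[cite: AlaogluErdos1944, §3, p. 455] -/
theorem caSeq_dvd_succ_of_alaogluErdosConjecture (hAE : AlaogluErdosConjecture) :
    caSeq_dvd_succ :=
  caSeq_dvd_succ_of_alaogluErdos hAE

/-- Under the Alaoglu–Erdős conjecture: `(caSeq (k+1) / caSeq k).Prime ∧ caSeq k ∣ caSeq (k+1)`
for every `k` — the shape of route item `RobinAlaogluErdosFourExp`
(Summits/RiemannHypothesis, Theses/Robin) from the weaker hypothesis; with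
`Nat.alaogluErdosConjecture_of_fourExponentialsConjecture` it gives that item, cf. the tree's
`Nat.caSeq_div_prime_of_fourExponentials`. [cite: AlaogluErdos1944, §3, p. 455] -/
theorem caSeq_div_prime_of_alaogluErdosConjecture (hAE : AlaogluErdosConjecture) (k : ℕ) :
    (caSeq (k + 1) / caSeq k).Prime ∧ caSeq k ∣ caSeq (k + 1) :=
  caSeq_div_prime_of_alaogluErdos hAE k

/-- Under the Alaoglu–Erdős conjecture all colossally abundant numbers (tree convention) are
pairwise comparable under divisibility (Lagarias 2002, §2: a positive answer excludes "four
extremal integers"). [cite: Lagarias2002, §2] -/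
theorem ColossallyAbundant.dvd_of_le_of_alaogluErdosConjecture (hAE : AlaogluErdosConjecture)
    {n n' : ℕ} (hn : ColossallyAbundant n) (hn' : ColossallyAbundant n') (hle : n ≤ n') :
    n ∣ n' :=
  hn.dvd_of_le (caSeq_dvd_succ_of_alaogluErdosConjecture hAE) hn' hle

end Nat

end
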